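import Mathlib
import HarnessLib
import Summits.Ventures.LatticeQCDFlow.Exactness.FlowSamplerTranslationCovariance
import Summits.Ventures.LatticeQCDFlow.Exactness.SUNStoutFlowSamplerErgodic
import Summits.Ventures.LatticeQCDFlow.Exactness.SUNStoutLayerTranslation

/-!
# The `SU(N)` stout-flow sampler commutes with every mask-preserving lattice translation: its law from the hot start is translation invariant at EVERY step and its plaquette one-point functions have the period of the mask

HONEST FRAMING: exact (Metropolis-corrected) sampling algorithms for lattice gauge theory;
figures of merit are autocorrelation/cost numbers at stated couplings and volumes; no
continuum-physics claim.

Venture `LatticeQCDFlow` (cell pub-lqcd), topic `Exactness`; FANOUT row 10 (`eng-equiv`, engine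
`latflow.equiv` / `latflow.flows_jax`: the masked `SU(N)` stout / residual layer of `residual.py`,
`flows_jax.residual_flow`, proposed through `make_proposer` and Metropolis-corrected by
`equiv/imh.py`).  NEW WORK of the cell; nothing is cited as a fact; no number; no definition is
introduced.  `SUNStoutFlowSamplerErgodic.stout_flowSampler_exact_uniformlyErgodic` says the sampler
"propose `Ψ_* Haar^⊗`, accept with `min(1, w(U')/w(U))`, `w = e^{−βS_W}·(J∘Ψ⁻¹)`" is exact and
uniformly ergodic; `FlowSamplerTranslationCovariance.conjKernel_wilsonFlowSampler_configTranslate`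
says a Wilson flow sampler with a continuous exact Jacobian commutes with every translation the
flow intertwines; GEN-15's `KernelCouplingTranslation.sunStoutLayer_siteTranslate` says the masked
stout layer intertwines every translation preserving its mask (coefficients translation covariant).
This file composes the three.

* **`conjKernel_stoutFlowSampler_configTranslate`** — every `N`, `d`, `L`; mask `p`, coefficient
  field `ρ`, `Ψ` the masked stout step presented as a measurable automorphism
  (`SUNStoutLatticeLayer.exists_measurableEquiv_sunStoutLatticeLayer`), `J ≥ 0` any CONTINUOUS exact
  Jacobian of it (Liouville's `J` of `SUNStoutLayerJacobian`, or a certified continuous closed form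
  — they agree by `SUNResidualLayerJacobianUnique`), `v` with `p e ↔ p (e + v)` and
  `ρ(V·v, e) = ρ(V, e + v)`: `conjKernel K (T_v) = K` for
  `K = indepMH (Ψ_* Haar^⊗) (e^{−βS_W}·(J∘Ψ⁻¹))`;
* `stoutFlowSampler_hotStart_law_map_configTranslate` — from the hot start `Haar^⊗` the law of the
  run is `T_v`-invariant at every step `t`; `stoutFlowSampler_wilsonStart_law_map_configTranslate` —
  the same from the Wilson measure at ANY coupling `β₀` (the engine's `β`-bootstrapping / `transfer`
  start; `wilsonMeasure_map_configTranslate`);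
* `integral_stoutFlowSampler_hotStart_plaquette_configTranslate` —
  `E_t[φ(U_{x;ij})] = E_t[φ(U_{v+x;ij})]` at every step for those `v`: with the engine's direction
  masks (`directionMask_siteTranslate_of_ker`, `stripesPhase_apply_eq_zero`) the `v` of the width
  sublattice — out of equilibrium the one-point functions have the period of the MASK, and only at
  equilibrium (`wilsonMeasure_map_configTranslate`) the period of the lattice.

NOT here: the constant-coefficient specialisation is the case `ρ V e = r` (both hypotheses on `ρ`
trivial); multi-layer flows (compose `foldr_comp_siteTranslate` and `HasJacobian.comp` first, then
§2 of `FlowSamplerTranslationCovariance` applies verbatim); any number.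
-/

noncomputable section

namespace Summit.Ventures.LatticeQCDFlow.Exactness

open MeasureTheory ProbabilityTheory ProbabilityTheory.Kernel Set
open Literature.MathematicalPhysics.QuantumFieldTheory
open Literature.MathematicalPhysics.QuantumFieldTheory.Luscher2010
open scoped ENNReal Matrix

/-! ## The `SU(N)` stout flow sampler of `SUNStoutFlowSamplerErgodic` under mask-preserving translations -/

section Stout

variable {d L n : ℕ} [NeZero L]

/-- **The `SU(N)` stout-flow sampler for the Wilson action commutes with every mask-preserving
translation** (every `N`, `d`, `L`; mask `p` with frozen staples, coefficients `ρ` translation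
covariant with `2(d−1)|ρ| < 1`, `Ψ` the masked stout step as a measurable automorphism, `J ≥ 0` any
CONTINUOUS exact Jacobian of it — Liouville's of `SUNStoutLayerJacobian`, or a certified closed
form): `conjKernel K (T_v) = K` for the kernel
`K = indepMH (Ψ_* Haar^⊗) (e^{−βS_W} · (J ∘ Ψ⁻¹))` of `stout_flowSampler_exact_uniformlyErgodic`. -/
theorem conjKernel_stoutFlowSampler_configTranslate {N : ℕ}
    (ρW : Matrix.specialUnitaryGroup (Fin n) ℂ →* Matrix (Fin N) (Fin N) ℂ) (hρW : Continuous ρW) (β : ℝ)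
    (p : Edge d L → Prop) [DecidablePred p]
    (ρ : GaugeConfig d L (Matrix.specialUnitaryGroup (Fin n) ℂ) → Edge d L → ℝ)
    (Ψ : GaugeConfig d L (Matrix.specialUnitaryGroup (Fin n) ℂ) ≃ᵐ
      GaugeConfig d L (Matrix.specialUnitaryGroup (Fin n) ℂ))
    (hΨ : ⇑Ψ = fun (V : GaugeConfig d L (Matrix.specialUnitaryGroup (Fin n) ℂ)) (e : Edge d L) =>
      if p e then
        (⟨NormedSpace.exp ((ρ V e : ℂ) • suProj (plaquetteLoopSum V e.1 e.2)),
            exp_smul_suProj_mem (ρ V e) (plaquetteLoopSum V e.1 e.2)⟩ :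
          Matrix.specialUnitaryGroup (Fin n) ℂ) * V e
      else V e)
    {J : GaugeConfig d L (Matrix.specialUnitaryGroup (Fin n) ℂ) → ℝ} (hJc : Continuous J)
    (hJ0 : ∀ U, 0 ≤ J U)
    (hJac : HasJacobian (Measure.pi fun _ : Edge d L => haarProbability (Matrix.specialUnitaryGroup (Fin n) ℂ))
      Ψ (fun U => ENNReal.ofReal (J U)))
    (v : Site d L) (hpv : ∀ e : Edge d L, p e ↔ p (e.1 + v, e.2))
    (hρv : ∀ (V : GaugeConfig d L (Matrix.specialUnitaryGroup (Fin n) ℂ)) (e : Edge d L), p e →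
      ρ (GaugeConfig.siteTranslate v V) e = ρ V (e.1 + v, e.2)) :
    haveI : IsProbabilityMeasure
        ((Measure.pi fun _ : Edge d L => haarProbability (Matrix.specialUnitaryGroup (Fin n) ℂ)).map Ψ) :=
      Measure.isProbabilityMeasure_map Ψ.measurable.aemeasurable
    conjKernel (indepMH ((Measure.pi fun _ : Edge d L =>
          haarProbability (Matrix.specialUnitaryGroup (Fin n) ℂ)).map Ψ)
        (fun U => Real.exp (-β * wilsonAction ρW U) * J (Ψ.symm U))) (configTranslate v) =
      indepMH ((Measure.pi fun _ : Edge d L =>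
          haarProbability (Matrix.specialUnitaryGroup (Fin n) ℂ)).map Ψ)
        (fun U => Real.exp (-β * wilsonAction ρW U) * J (Ψ.symm U)) := by
  haveI : SecondCountableTopology (Matrix (Fin n) (Fin n) ℂ) :=
    inferInstanceAs (SecondCountableTopology (Fin n → Fin n → ℂ))
  haveI : SecondCountableTopology (Matrix.specialUnitaryGroup (Fin n) ℂ) :=
    Topology.IsEmbedding.subtypeVal.secondCountableTopology
  have hcomm : ∀ V : GaugeConfig d L (Matrix.specialUnitaryGroup (Fin n) ℂ),
      Ψ (GaugeConfig.siteTranslate v V) = GaugeConfig.siteTranslate v (Ψ V) := fun V => by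
    rw [hΨ]
    exact sunStoutLayer_siteTranslate p p v ρ hpv hρv V
  exact conjKernel_wilsonFlowSampler_configTranslate ρW hρW β Ψ hJc hJ0 hJac v hcomm

/-- **Hot start: the law of the `SU(N)` stout-flow-sampler run is invariant under every
mask-preserving translation at every step.** -/
theorem stoutFlowSampler_hotStart_law_map_configTranslate {N : ℕ}
    (ρW : Matrix.specialUnitaryGroup (Fin n) ℂ →* Matrix (Fin N) (Fin N) ℂ) (hρW : Continuous ρW) (β : ℝ)
    (p : Edge d L → Prop) [DecidablePred p]
    (ρ : GaugeConfig d L (Matrix.specialUnitaryGroup (Fin n) ℂ) → Edge d L → ℝ)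
    (Ψ : GaugeConfig d L (Matrix.specialUnitaryGroup (Fin n) ℂ) ≃ᵐ
      GaugeConfig d L (Matrix.specialUnitaryGroup (Fin n) ℂ))
    (hΨ : ⇑Ψ = fun (V : GaugeConfig d L (Matrix.specialUnitaryGroup (Fin n) ℂ)) (e : Edge d L) =>
      if p e then
        (⟨NormedSpace.exp ((ρ V e : ℂ) • suProj (plaquetteLoopSum V e.1 e.2)),
            exp_smul_suProj_mem (ρ V e) (plaquetteLoopSum V e.1 e.2)⟩ :
          Matrix.specialUnitaryGroup (Fin n) ℂ) * V e
      else V e)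
    {J : GaugeConfig d L (Matrix.specialUnitaryGroup (Fin n) ℂ) → ℝ} (hJc : Continuous J)
    (hJ0 : ∀ U, 0 ≤ J U)
    (hJac : HasJacobian (Measure.pi fun _ : Edge d L => haarProbability (Matrix.specialUnitaryGroup (Fin n) ℂ))
      Ψ (fun U => ENNReal.ofReal (J U)))
    (v : Site d L) (hpv : ∀ e : Edge d L, p e ↔ p (e.1 + v, e.2))
    (hρv : ∀ (V : GaugeConfig d L (Matrix.specialUnitaryGroup (Fin n) ℂ)) (e : Edge d L), p e →
      ρ (GaugeConfig.siteTranslate v V) e = ρ V (e.1 + v, e.2)) (t : ℕ) :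
    haveI : IsProbabilityMeasure
        ((Measure.pi fun _ : Edge d L => haarProbability (Matrix.specialUnitaryGroup (Fin n) ℂ)).map Ψ) :=
      Measure.isProbabilityMeasure_map Ψ.measurable.aemeasurable
    ((Measure.pi fun _ : Edge d L => haarProbability (Matrix.specialUnitaryGroup (Fin n) ℂ)).bind
        (nHit (indepMH ((Measure.pi fun _ : Edge d L =>
            haarProbability (Matrix.specialUnitaryGroup (Fin n) ℂ)).map Ψ)
          (fun U => Real.exp (-β * wilsonAction ρW U) * J (Ψ.symm U))) t)).map (configTranslate v) =
      (Measure.pi fun _ : Edge d L => haarProbability (Matrix.specialUnitaryGroup (Fin n) ℂ)).bind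
        (nHit (indepMH ((Measure.pi fun _ : Edge d L =>
            haarProbability (Matrix.specialUnitaryGroup (Fin n) ℂ)).map Ψ)
          (fun U => Real.exp (-β * wilsonAction ρW U) * J (Ψ.symm U))) t) :=
  Scoring.map_bind_nHit_eq_self
    (conjKernel_stoutFlowSampler_configTranslate ρW hρW β p ρ Ψ hΨ hJc hJ0 hJac v hpv hρv)
    (piHaar_map_configTranslate n v) t

/-- **Hot start: plaquette one-point functions of the `SU(N)` stout-flow-sampler run have the
period of the mask at every step** — `E_t[φ(U_{x;ij})] = E_t[φ(U_{v+x;ij})]` for every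
mask-preserving `v`. -/
theorem integral_stoutFlowSampler_hotStart_plaquette_configTranslate {N : ℕ}
    (ρW : Matrix.specialUnitaryGroup (Fin n) ℂ →* Matrix (Fin N) (Fin N) ℂ) (hρW : Continuous ρW) (β : ℝ)
    (p : Edge d L → Prop) [DecidablePred p]
    (ρ : GaugeConfig d L (Matrix.specialUnitaryGroup (Fin n) ℂ) → Edge d L → ℝ)
    (Ψ : GaugeConfig d L (Matrix.specialUnitaryGroup (Fin n) ℂ) ≃ᵐ
      GaugeConfig d L (Matrix.specialUnitaryGroup (Fin n) ℂ))
    (hΨ : ⇑Ψ = fun (V : GaugeConfig d L (Matrix.specialUnitaryGroup (Fin n) ℂ)) (e : Edge d L) =>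
      if p e then
        (⟨NormedSpace.exp ((ρ V e : ℂ) • suProj (plaquetteLoopSum V e.1 e.2)),
            exp_smul_suProj_mem (ρ V e) (plaquetteLoopSum V e.1 e.2)⟩ :
          Matrix.specialUnitaryGroup (Fin n) ℂ) * V e
      else V e)
    {J : GaugeConfig d L (Matrix.specialUnitaryGroup (Fin n) ℂ) → ℝ} (hJc : Continuous J)
    (hJ0 : ∀ U, 0 ≤ J U)
    (hJac : HasJacobian (Measure.pi fun _ : Edge d L => haarProbability (Matrix.specialUnitaryGroup (Fin n) ℂ))
      Ψ (fun U => ENNReal.ofReal (J U)))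
    (v : Site d L) (hpv : ∀ e : Edge d L, p e ↔ p (e.1 + v, e.2))
    (hρv : ∀ (V : GaugeConfig d L (Matrix.specialUnitaryGroup (Fin n) ℂ)) (e : Edge d L), p e →
      ρ (GaugeConfig.siteTranslate v V) e = ρ V (e.1 + v, e.2)) (t : ℕ)
    {F : Type*} [NormedAddCommGroup F] [NormedSpace ℝ F] (φ : Matrix.specialUnitaryGroup (Fin n) ℂ → F)
    (i j : Fin d) (x : Site d L) :
    haveI : IsProbabilityMeasure
        ((Measure.pi fun _ : Edge d L => haarProbability (Matrix.specialUnitaryGroup (Fin n) ℂ)).map Ψ) :=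
      Measure.isProbabilityMeasure_map Ψ.measurable.aemeasurable
    ∫ U, φ (plaquetteHolonomy U x i j) ∂((Measure.pi fun _ : Edge d L =>
        haarProbability (Matrix.specialUnitaryGroup (Fin n) ℂ)).bind
        (nHit (indepMH ((Measure.pi fun _ : Edge d L =>
            haarProbability (Matrix.specialUnitaryGroup (Fin n) ℂ)).map Ψ)
          (fun U => Real.exp (-β * wilsonAction ρW U) * J (Ψ.symm U))) t)) =
      ∫ U, φ (plaquetteHolonomy U (v + x) i j) ∂((Measure.pi fun _ : Edge d L =>
        haarProbability (Matrix.specialUnitaryGroup (Fin n) ℂ)).bind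
        (nHit (indepMH ((Measure.pi fun _ : Edge d L =>
            haarProbability (Matrix.specialUnitaryGroup (Fin n) ℂ)).map Ψ)
          (fun U => Real.exp (-β * wilsonAction ρW U) * J (Ψ.symm U))) t)) := by
  have h := (MeasurePreserving.mk (configTranslate v).measurable
    (stoutFlowSampler_hotStart_law_map_configTranslate ρW hρW β p ρ Ψ hΨ hJc hJ0 hJac v hpv hρv t)).integral_comp'
    (fun U => φ (plaquetteHolonomy U x i j))
  simp only [plaquetteHolonomy_configTranslate] at h
  exact h.symm

/-- **β-bootstrap / warm start: from the Wilson measure at ANY coupling `β₀` the law of the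
`SU(N)` stout-flow-sampler run (target coupling `β`) is invariant under every mask-preserving
translation at every step** (`wilsonMeasure_map_configTranslate` supplies the invariant start —
the engine's `transfer` / bootstrapping in `β`). -/
theorem stoutFlowSampler_wilsonStart_law_map_configTranslate {N : ℕ}
    (ρW : Matrix.specialUnitaryGroup (Fin n) ℂ →* Matrix (Fin N) (Fin N) ℂ) (hρW : Continuous ρW) (β β₀ : ℝ)
    (p : Edge d L → Prop) [DecidablePred p]
    (ρ : GaugeConfig d L (Matrix.specialUnitaryGroup (Fin n) ℂ) → Edge d L → ℝ)
    (Ψ : GaugeConfig d L (Matrix.specialUnitaryGroup (Fin n) ℂ) ≃ᵐ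
      GaugeConfig d L (Matrix.specialUnitaryGroup (Fin n) ℂ))
    (hΨ : ⇑Ψ = fun (V : GaugeConfig d L (Matrix.specialUnitaryGroup (Fin n) ℂ)) (e : Edge d L) =>
      if p e then
        (⟨NormedSpace.exp ((ρ V e : ℂ) • suProj (plaquetteLoopSum V e.1 e.2)),
            exp_smul_suProj_mem (ρ V e) (plaquetteLoopSum V e.1 e.2)⟩ :
          Matrix.specialUnitaryGroup (Fin n) ℂ) * V e
      else V e)
    {J : GaugeConfig d L (Matrix.specialUnitaryGroup (Fin n) ℂ) → ℝ} (hJc : Continuous J)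
    (hJ0 : ∀ U, 0 ≤ J U)
    (hJac : HasJacobian (Measure.pi fun _ : Edge d L => haarProbability (Matrix.specialUnitaryGroup (Fin n) ℂ))
      Ψ (fun U => ENNReal.ofReal (J U)))
    (v : Site d L) (hpv : ∀ e : Edge d L, p e ↔ p (e.1 + v, e.2))
    (hρv : ∀ (V : GaugeConfig d L (Matrix.specialUnitaryGroup (Fin n) ℂ)) (e : Edge d L), p e →
      ρ (GaugeConfig.siteTranslate v V) e = ρ V (e.1 + v, e.2)) (t : ℕ) :
    haveI : IsProbabilityMeasure
        ((Measure.pi fun _ : Edge d L => haarProbability (Matrix.specialUnitaryGroup (Fin n) ℂ)).map Ψ) :=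
      Measure.isProbabilityMeasure_map Ψ.measurable.aemeasurable
    ((wilsonMeasure (d := d) (L := L) ρW β₀).bind
        (nHit (indepMH ((Measure.pi fun _ : Edge d L =>
            haarProbability (Matrix.specialUnitaryGroup (Fin n) ℂ)).map Ψ)
          (fun U => Real.exp (-β * wilsonAction ρW U) * J (Ψ.symm U))) t)).map (configTranslate v) =
      (wilsonMeasure (d := d) (L := L) ρW β₀).bind
        (nHit (indepMH ((Measure.pi fun _ : Edge d L =>
            haarProbability (Matrix.specialUnitaryGroup (Fin n) ℂ)).map Ψ)
          (fun U => Real.exp (-β * wilsonAction ρW U) * J (Ψ.symm U))) t) := by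
  haveI : SecondCountableTopology (Matrix (Fin n) (Fin n) ℂ) :=
    inferInstanceAs (SecondCountableTopology (Fin n → Fin n → ℂ))
  haveI : SecondCountableTopology (Matrix.specialUnitaryGroup (Fin n) ℂ) :=
    Topology.IsEmbedding.subtypeVal.secondCountableTopology
  have hcomm : ∀ V : GaugeConfig d L (Matrix.specialUnitaryGroup (Fin n) ℂ),
      Ψ (GaugeConfig.siteTranslate v V) = GaugeConfig.siteTranslate v (Ψ V) := fun V => by
    rw [hΨ]
    exact sunStoutLayer_siteTranslate p p v ρ hpv hρv V
  exact wilsonFlowSampler_law_map_configTranslate ρW hρW β Ψ hJc hJ0 hJac v hcomm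
    (wilsonMeasure_map_configTranslate ρW β₀ v) t

end Stout

end Summit.Ventures.LatticeQCDFlow.Exactness

end
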